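import Summits.BirchSwinnertonDyer.BirchSwinnertonDyer.Theorems.ByReductionTypeAtTwoRankOneAtTwoOneDoorFirstDescentDefs
import Summits.BirchSwinnertonDyer.BirchSwinnertonDyer.Theorems.ByReductionTypeAtTwoRankOneAtTwoBigImageOddLocalOneDoorBottomReciprocity
import Summits.BirchSwinnertonDyer.BirchSwinnertonDyer.Theorems.GenusKolyvaginAtTwoEquivariantKolyvaginExactAtTwoTwinGrossPrimes
import HarnessLib

/-!
# Route ByReductionTypeAtTwo, crux `RankOneAtTwoBigImageOddLocal` (stmt-BirchSwinnertonDyer-23715), LINE v8.9 `one_door_analytic`: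
# the leaves `rec₁`, `rec₂` of `FirstDescentInput` in the lead's currency (`RatPlace`, `locAt`, `strictAt`, level `2`) — DISCHARGED

Width prover seat `bsd-line-fkl-p2` g10 (2026-08-28), `--supports stmt-BirchSwinnertonDyer-23715` (helper).  THEOREMS ONLY (no
definition, no named fact, no `sorry`).  BSD is not proved by any of this.  Sibling of `…OneDoorBottomLeavesLines.lean` (the `line`
fields); re-indexes the width seat's RECIPROCITY leaf (`…OneDoorBottomReciprocity.lean`, p640864: Poitou–Tate with one error place + Tate
local duality at a Kolyvagin prime, proved over gk2's `Place ℚ = InfinitePlace ℚ ⊕ HeightOneSpectrum (𝓞 ℚ)` at level `((2 : ℕ) : ℤ)`)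
into EXACTLY the field shapes `rec₁` / `rec₂` of the lead's `FirstDescentInput W Wd` (`…OneDoorFirstDescentDefs.lean`, p641630):

* §1 `rec_inl_of_card` — any `X/ℚ`, Kolyvagin prime `ℓ` at `pl ℓ = Sum.inl v`, FINITE error place `q₀ = Sum.inl v₀ ≠ Sum.inl v`, from the
  count `#X(ℚ_v)[2] = 2`;
* §2 the counts DISCHARGED on `Δ_W < 0`: `rec₁_inl` for `W` at a Gross–Kolyvagin prime (`FrobEqFrobInfty W K 2 ℓ`, index `≥ 1`) and
  `rec₂_inl` for a globally minimal twin `Wd` (`TwinGrossPrimes.natCard_ker_zsmul_adicCompletion_two_pow_eq_twin`, `d_K` odd, `ℓ ∤ d_K`);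
(The ARCHIMEDEAN error place `q₀ = Sum.inr ∞` — the `Δ_W > 0` corner, regular Kolyvagin primes — follows the same pattern from
`…OneDoorBottomReciprocity` §2 with `v₀ = ∞`; it is filed separately once `…OneDoorBottomLeavesLines` is importable.)

References: [GrossLMS1991] Prop. 8.2, §10; [McCallumLMS1991] Lemma 5.3, Prop. 2.2; [MazurRubin2010] Prop. 3.3; [Kramer1981] Prop. 6.
-/

set_option autoImplicit false
-- the Theorems namespace of this sub repeats the summit name by design (D-0017 nested layout)
set_option linter.dupNamespace false

noncomputable section

open scoped Classical AddSubgroup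

namespace Summit.BirchSwinnertonDyer.BirchSwinnertonDyer.Theorems.RankOneAtTwoOneDoor

open WeierstrassCurve NumberField IsDedekindDomain Field
open Literature.NumberTheory.EllipticCurves Literature.NumberTheory.GaloisRepresentations
open Literature.NumberTheory.GaloisCohomology
open Summit.BirchSwinnertonDyer.BirchSwinnertonDyer.Theorems.GenusExact

/-! ## §1 `rec₁` / `rec₂` at a Kolyvagin prime and a finite error place from the local count -/

/-- Re-indexing `RatPlace → Place ℚ` of a relaxedness hypothesis off two finite places. [folklore] -/
theorem forall_place_of_forall_ratPlace₂ (X : WeierstrassCurve ℚ) {v v₀ : HeightOneSpectrum (𝓞 ℚ)} {d : galH1Torsion X 2}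
    (hd : ∀ w : RatPlace, w ≠ Sum.inl v → w ≠ Sum.inl v₀ → d ∈ locAt X 2 w) :
    ∀ w : Place ℚ, w ≠ Sum.inr v → w ≠ Sum.inr v₀ → d ∈ selmerLocalKer X (Place.Completion w) ((2 : ℕ) : ℤ) := by
  rintro (w | w) h1 h2
  · exact hd (Sum.inr w) Sum.inr_ne_inl Sum.inr_ne_inl
  · exact hd (Sum.inl w) (fun h => h1 (by rw [Sum.inl_injective h])) (fun h => h2 (by rw [Sum.inl_injective h]))

/-- Re-indexing `RatPlace → Place ℚ` of a relaxedness hypothesis off one finite place. [folklore] -/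
theorem forall_place_of_forall_ratPlace₁ (X : WeierstrassCurve ℚ) {v₀ : HeightOneSpectrum (𝓞 ℚ)} {s : galH1Torsion X 2}
    (hs : ∀ w : RatPlace, w ≠ Sum.inl v₀ → s ∈ locAt X 2 w) :
    ∀ w : Place ℚ, w ≠ Sum.inr v₀ → s ∈ selmerLocalKer X (Place.Completion w) ((2 : ℕ) : ℤ) := by
  rintro (w | w) h1
  · exact hs (Sum.inr w) Sum.inr_ne_inl
  · exact hs (Sum.inl w) (fun h => h1 (by rw [Sum.inl_injective h]))

/-- **Field `rec₁` / `rec₂` of `FirstDescentInput` at `pl ℓ = Sum.inl v`, `q₀ = Sum.inl v₀ ≠ Sum.inl v`** from the count `#X(ℚ_v)[2] = 2`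
at an odd prime `ℓ ∣ v`: a class `d` Selmer off `{v, v₀}` and not Selmer at `v` forces every `s` Selmer off `v₀` with `s_v ≠ 0` to have
`s_{v₀} ≠ 0` (`hrec_at_of_card` re-indexed: Poitou–Tate with the one error place `v₀` + Tate local duality at `v`).
[cite: GrossLMS1991, §10 (Claim 10.1), Prop. 8.2] [cite: McCallumLMS1991, §5 Lemma 5.3] -/
theorem rec_inl_of_card (X : WeierstrassCurve ℚ) [X.IsElliptic] {ℓ : ℕ} [Fact ℓ.Prime] (hℓ2 : ℓ ≠ 2)
    {v : HeightOneSpectrum (𝓞 ℚ)} (hℓv : (ℓ : 𝓞 ℚ) ∈ v.asIdeal)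
    (hcard : Nat.card (nsmulAddMonoidHom 2 : (X.baseChange (v.adicCompletion ℚ)).toAffine.Point →+ _).ker = 2)
    (v₀ : HeightOneSpectrum (𝓞 ℚ)) (hv₀ : v₀ ≠ v) :
    ∀ d : galH1Torsion X 2, (∀ w : RatPlace, w ≠ Sum.inl v → w ≠ Sum.inl v₀ → d ∈ locAt X 2 w) → d ∉ locAt X 2 (Sum.inl v) →
      ∀ s : galH1Torsion X 2, (∀ w : RatPlace, w ≠ Sum.inl v₀ → s ∈ locAt X 2 w) → s ∉ strictAt X 2 (Sum.inl v) →
        s ∉ strictAt X 2 (Sum.inl v₀) :=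
  fun d hd hdv s hs hsv =>
    hrec_at_of_card X hℓ2 hℓv hcard v₀ hv₀ d (forall_place_of_forall_ratPlace₂ X hd) hdv s (forall_place_of_forall_ratPlace₁ X hs) hsv

/-! ## §2 The counts discharged on `Δ_W < 0` -/

/-- **`rec₁` for `W` at a Gross–Kolyvagin prime, UNCONDITIONAL** (`W` globally minimal, `Δ_W < 0`, `ℓ` odd good with `Frob_ℓ ∼ Frob_∞` of
index `≥ 1` — then `#E(ℚ_ℓ)[2] = 2`; `hrec_at` re-indexed). [cite: GrossLMS1991, §10, Prop. 8.2] [cite: McCallumLMS1991, §5 Lemma 5.3] -/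
theorem rec₁_inl (W : WeierstrassCurve ℚ) [W.IsElliptic] [W.IsGloballyMinimal] (hΔ : W.Δ < 0) {ℓ : ℕ} [Fact ℓ.Prime] (hℓ2 : ℓ ≠ 2)
    {v : HeightOneSpectrum (𝓞 ℚ)} (hℓv : (ℓ : 𝓞 ℚ) ∈ v.asIdeal) (hgood : W.HasGoodReductionAtPrime ℓ) {K : Type} [Field K]
    [NumberField K] (hℓK : FrobEqFrobInfty W K 2 ℓ) (h1ℓ : 1 ≤ Zhang2014.kolyvaginIndex W 2 ℓ)
    (v₀ : HeightOneSpectrum (𝓞 ℚ)) (hv₀ : v₀ ≠ v) :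
    ∀ d : galH1Torsion W 2, (∀ w : RatPlace, w ≠ Sum.inl v → w ≠ Sum.inl v₀ → d ∈ locAt W 2 w) → d ∉ locAt W 2 (Sum.inl v) →
      ∀ s : galH1Torsion W 2, (∀ w : RatPlace, w ≠ Sum.inl v₀ → s ∈ locAt W 2 w) → s ∉ strictAt W 2 (Sum.inl v) →
        s ∉ strictAt W 2 (Sum.inl v₀) :=
  fun d hd hdv s hs hsv =>
    hrec_at W hΔ hℓ2 hℓv hgood hℓK h1ℓ v₀ hv₀ d (forall_place_of_forall_ratPlace₂ W hd) hdv s (forall_place_of_forall_ratPlace₁ W hs) hsv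

/-- **`rec₂` for a globally minimal twin `Wd` of `W` by `d_K` at a Gross–Kolyvagin prime of `(W, K)`, UNCONDITIONAL** (`Δ_W < 0`, `d_K` odd,
`ℓ ∤ d_K`; the twin count `#Wd(ℚ_ℓ)[2] = 2` is `TwinGrossPrimes.natCard_ker_zsmul_adicCompletion_two_pow_eq_twin` at `M = 1`).
[cite: GrossLMS1991, §10, Prop. 8.2] [cite: McCallumLMS1991, §5 Lemma 5.3] [cite: MazurRubin2010, Lemma 2.10] -/
theorem rec₂_inl (W : WeierstrassCurve ℚ) [W.IsElliptic] [W.IsGloballyMinimal] (hΔ : W.Δ < 0)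
    {K : Type} [Field K] [NumberField K] (hK : IsImaginaryQuadratic K) (hodd : Odd (NumberField.discr K))
    (Wd : WeierstrassCurve ℚ) [Wd.IsElliptic] [Wd.IsGloballyMinimal] {Cd : VariableChange ℚ}
    (hWd : Cd • W.quadraticTwist ((NumberField.discr K : ℤ) : ℚ) = Wd)
    {ℓ : ℕ} [Fact ℓ.Prime] (hℓ2 : ℓ ≠ 2) (hℓd : ¬ ((ℓ : ℤ) ∣ NumberField.discr K)) (hgood : W.HasGoodReductionAtPrime ℓ)
    (hℓK : FrobEqFrobInfty W K 2 ℓ) {v : HeightOneSpectrum (𝓞 ℚ)} (hℓv : (ℓ : 𝓞 ℚ) ∈ v.asIdeal)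
    (h1ℓ : 1 ≤ Zhang2014.kolyvaginIndex W 2 ℓ) (v₀ : HeightOneSpectrum (𝓞 ℚ)) (hv₀ : v₀ ≠ v) :
    ∀ d : galH1Torsion Wd 2, (∀ w : RatPlace, w ≠ Sum.inl v → w ≠ Sum.inl v₀ → d ∈ locAt Wd 2 w) → d ∉ locAt Wd 2 (Sum.inl v) →
      ∀ s : galH1Torsion Wd 2, (∀ w : RatPlace, w ≠ Sum.inl v₀ → s ∈ locAt Wd 2 w) → s ∉ strictAt Wd 2 (Sum.inl v) →
        s ∉ strictAt Wd 2 (Sum.inl v₀) := by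
  refine rec_inl_of_card Wd hℓ2 hℓv ?_ v₀ hv₀
  have h := TwinGrossPrimes.natCard_ker_zsmul_adicCompletion_two_pow_eq_twin W hK hodd hΔ Wd hWd hℓ2 hℓd hgood hℓK hℓv (M := 1) h1ℓ
  have he : (zsmulAddGroupHom ((2 ^ 1 : ℕ) : ℤ) : (Wd.baseChange (v.adicCompletion ℚ)).toAffine.Point →+ _) = nsmulAddMonoidHom 2 :=
    AddMonoidHom.ext fun a => by rw [zsmulAddGroupHom_apply, nsmulAddMonoidHom_apply, pow_one, natCast_zsmul]
  rw [he, pow_one] at h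
  exact h

end Summit.BirchSwinnertonDyer.BirchSwinnertonDyer.Theorems.RankOneAtTwoOneDoor

end
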